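import Summits.CriticalPhenomena.PercolationContinuityZ3.Theorems.PercAnnulusCrossingIICCondFatZd
import Summits.CriticalPhenomena.PercolationContinuityZ3.Theorems.PercAnnulusCrossingIICCondFatOfRobustUniq
import Summits.CriticalPhenomena.PercolationContinuityZ3.Theorems.PercAnnulusCrossingIICCondFatZ3OfNonCrossing
import Summits.CriticalPhenomena.PercolationContinuityZ3.Theorems.PercNearOneGluingNoHeavyRsw3IICVolumeMoments
import HarnessLib

/-!
# Kesten's Theorem (8) in all moments, two-sided, under robust annulus-uniqueness (lane RSW3, p1 gen 18)

builds on p205010 (kernel theorem, internal audit signed; external expert review pending) — NOT used in this file.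

RSW3 lane (LANE 3 `prim-rsw3`), seat `prim-rsw3-p1` (gen 18).  Helper file (`--supports stmt-CriticalPhenomena-4575`);
no definitions, no sorries.  Memo `run/shared/lean/prim/rsw3/P1-QM.md` §31.

p2 gen 21 (`…Rsw3IICVolumeMoments`) proved the upper half of Kesten's Theorem (8) in every moment,
`E_ν|C(0) ∩ Λ(n)|^{t+1} ≤ C (n^d π_{p_c}(n))^{t+1}`, under (A2)□ alone, and the lower half under COUNT TIGHTNESS of the annulus
crossing-cluster number.  Gen 17's power-law lower tail `ν(V_n ≤ ε(2n+1)^dπ(n)) ≤ Cε^c` (under (A2)□ + `CU⁺_l` + UAD) gives the lower half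
by Markov's inequality, so:

* `integral_volume_pow_ge_of_lowerTail` — abstract step: a lower tail `ν(V_n ≤ εσ'_n) ≤ Cε^c` at one `ε₀` with `Cε₀^c ≤ 1/2` gives
  `E_ν V_n^{t+1} ≥ (ε₀^{t+1}/2)·(n^dπ(n))^{t+1}`;
* **`iicMeasure_integral_volume_pow_two_sided_of_robustCondAnnulusUniq`** — at `p_c(ℤ^d)`, `d ≥ 2`, under (A2)□(s,L) + `CU⁺_l(c_U)` + UAD:
  for every `t` there are `0 < c, C` with **`c (n^dπ_{p_c}(n))^{t+1} ≤ E_ν|C(0) ∩ Λ(n)|^{t+1} ≤ C (n^dπ_{p_c}(n))^{t+1}`** for all `n ≥ 1` and every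
  IIC probability measure `ν` — KESTEN'S (8) IN ALL MOMENTS WITHOUT COUNT TIGHTNESS; `…_Z3_of_critAnnulusNonCrossing` — on `ℤ³` under
  (A2)□(s,L) + `CU⁺_l` + X_B.
References: H. Kesten, PTRF 73 (1986) Thm. (8); D. Basu, A. Sapozhnikov, ECP 22 (2017) Thm. 1.1.
-/

noncomputable section

namespace Summit.CriticalPhenomena.PercolationContinuityZ3.Theorems.Crossing

open MeasureTheory Filter Topology Literature.Probability.Percolation Literature.Probability.LatticeModels
open Literature.Probability.Percolation.DCT16
open Summit.CriticalPhenomena.PercolationContinuityZ3.Theses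
open Summit.CriticalPhenomena.PercolationContinuityZ3.Theorems.SurfaceTension

variable {d : ℕ}

open Classical in
/-- **Lower moments from a lower tail (Markov).**  If `ν(V_n ≤ ε₀(2n+1)^dπ(n)) ≤ 1/2` for a probability measure `ν` (`ε₀ > 0`, `n ≥ 1`,
`V_n = #{z ∈ Λ(n) : 0 ↔ z}`), then `(ε₀^{t}/2)·(n^d π_p(n))^{t} ≤ E_ν V_n^{t}`. [cite: Kesten1986, Thm. (8)] -/
theorem integral_volume_pow_ge_of_lowerTail (p : unitInterval) {ν : Measure (BondConfig (Site d))} [IsProbabilityMeasure ν]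
    {n : ℕ} {ε₀ : ℝ} (hε₀ : 0 < ε₀)
    (htail : ν.real {ω | ((((box d n).filter fun z => ω ∈ (openConn (0 : Site d) z : Set (BondConfig (Site d)))).card : ℕ) : ℝ) ≤
        ε₀ * (2 * (n : ℝ) + 1) ^ d * oneArmProb d p n} ≤ 1 / 2) (t : ℕ) :
    ε₀ ^ t / 2 * ((n : ℝ) ^ d * oneArmProb d p n) ^ t ≤
      ∫ ω, ((((box d n).filter fun z => ω ∈ (openConn (0 : Site d) z : Set (BondConfig (Site d)))).card : ℕ) : ℝ) ^ t ∂ν := by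
  set V : BondConfig (Site d) → ℝ := fun ω =>
    ((((box d n).filter fun z => ω ∈ (openConn (0 : Site d) z : Set (BondConfig (Site d)))).card : ℕ) : ℝ) with hV
  set a : ℝ := ε₀ * (2 * (n : ℝ) + 1) ^ d * oneArmProb d p n with ha
  have hπ : 0 ≤ oneArmProb d p n := measureReal_nonneg
  have hn0 : (0 : ℝ) ≤ n := Nat.cast_nonneg n
  have ha0 : 0 ≤ a := by rw [ha]; exact mul_nonneg (mul_nonneg hε₀.le (pow_nonneg (by linarith) d)) hπ
  -- `ν{a ≤ V} ≥ 1/2`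
  have hge : 1 / 2 ≤ ν.real {ω | a ≤ V ω} := by
    have hsub : Set.univ ⊆ {ω | V ω ≤ a} ∪ {ω | a ≤ V ω} := fun ω _ => by
      rcases le_total (V ω) a with h | h
      · exact Or.inl h
      · exact Or.inr h
    have h1 : (1 : ℝ) ≤ ν.real {ω | V ω ≤ a} + ν.real {ω | a ≤ V ω} := by
      calc (1 : ℝ) = ν.real Set.univ := by simp
        _ ≤ ν.real ({ω | V ω ≤ a} ∪ {ω | a ≤ V ω}) := measureReal_mono hsub
        _ ≤ _ := measureReal_union_le _ _
    have h2 : ν.real {ω | V ω ≤ a} ≤ 1 / 2 := htail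
    linarith
  have hmk := Rsw3.pow_mul_real_le_setIntegral_volume_pow ν n t ha0 Set.univ
  rw [Set.inter_univ, Measure.restrict_univ] at hmk
  have hcmp : ((n : ℝ) ^ d * oneArmProb d p n) ^ t ≤ ((2 * (n : ℝ) + 1) ^ d * oneArmProb d p n) ^ t := by
    refine pow_le_pow_left₀ (mul_nonneg (pow_nonneg hn0 d) hπ) ?_ _
    exact mul_le_mul_of_nonneg_right (pow_le_pow_left₀ hn0 (by linarith) d) hπ
  calc ε₀ ^ t / 2 * ((n : ℝ) ^ d * oneArmProb d p n) ^ t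
      ≤ ε₀ ^ t / 2 * ((2 * (n : ℝ) + 1) ^ d * oneArmProb d p n) ^ t :=
        mul_le_mul_of_nonneg_left hcmp (by positivity)
    _ = a ^ t * (1 / 2) := by rw [ha, mul_assoc ε₀, mul_pow]; ring
    _ ≤ a ^ t * ν.real {ω | a ≤ V ω} := mul_le_mul_of_nonneg_left hge (pow_nonneg ha0 _)
    _ ≤ _ := hmk

open Classical in
/-- **KESTEN'S THEOREM (8) IN ALL MOMENTS, TWO-SIDED, WITHOUT COUNT TIGHTNESS** (`p_c(ℤ^d)`, `d ≥ 2`; (A2)□ at aspect `(s,L)`, `2 ≤ s ≤ L`,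
`ϰ > 0`; robust conditional annulus-uniqueness `CU⁺_l(c_U)`, `l ≥ 2`, `c_U > 0`; uniform annulus decay UAD): for every `t` there are
`0 < c, C` such that for every probability measure `ν` with Kesten's IIC limit property and every `n ≥ 1`:
**`c·(n^dπ_{p_c}(n))^{t+1} ≤ E_ν|C(0) ∩ Λ(n)|^{t+1} ≤ C·(n^dπ_{p_c}(n))^{t+1}`** (upper half: p2 gen 21 under (A2)□; lower half: gen 17's
power-law lower tail + Markov). [cite: Kesten1986, Thm. (8)] [cite: BasuSapozhnikov2017ECP, Thm. 1.1] -/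
theorem iicMeasure_integral_volume_pow_two_sided_of_robustCondAnnulusUniq (hd : 2 ≤ d) {s L : ℕ} (hs : 2 ≤ s) (hsL : s ≤ L)
    {ϰ : ℝ} (hϰ : 0 < ϰ) (hA2 : SetToSetQuasiMultAspectAt d (criticalProbI d) s L ϰ) {l : ℕ} (hl : 2 ≤ l) {cU : ℝ} (hcU : 0 < cU)
    (hCU : ∀ a : ℕ, 1 ≤ a → ∀ E : Set (BondConfig (Site d)), IsUpperSet E → MeasurableSet E →
      cU * (bondPercolation (zdGraph d) (criticalProbI d)).real E ≤ (bondPercolation (zdGraph d) (criticalProbI d)).real (E ∩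
        {ω : BondConfig (Site d) | ∀ t ∈ innerBoundary (zdGraph d) (box d a), ∀ s ∈ innerBoundary (zdGraph d) (box d (l * a)),
          ∀ t' ∈ innerBoundary (zdGraph d) (box d a), ∀ s' ∈ innerBoundary (zdGraph d) (box d (l * a)),
          ω ∈ openConnIn (↑((box d (l * a) \ box d a) ∪ innerBoundary (zdGraph d) (box d a)) : Set (Site d)) t s →
          ω ∈ openConnIn (↑((box d (l * a) \ box d a) ∪ innerBoundary (zdGraph d) (box d a)) : Set (Site d)) t' s' →
          ω ∈ openConnIn (↑((box d (l * a) \ box d a) ∪ innerBoundary (zdGraph d) (box d a)) : Set (Site d)) s s'}))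
    (hUAD : ∀ ε : ℝ, 0 < ε → ∃ K₀ : ℕ, ∀ m : ℕ, 1 ≤ m → ∀ N : ℕ, K₀ * m ≤ N →
      (bondPercolation (zdGraph d) (criticalProbI d)).real (boxCrossing d m N) ≤ ε) (t : ℕ) :
    ∃ c C : ℝ, 0 < c ∧ 0 < C ∧ ∀ (ν : Measure (BondConfig (Site d))) [IsProbabilityMeasure ν],
      (∀ (K : Finset (Sym2 (Site d))) (E : Set (BondConfig (Site d))), MeasurableSet E → DeterminedBy E ↑K →
        Tendsto (fun n : ℕ => (bondPercolation (zdGraph d) (criticalProbI d)).real (E ∩ siteToBoundary d n) /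
          oneArmProb d (criticalProbI d) n) atTop (𝓝 (ν.real E))) →
      ∀ n : ℕ, 1 ≤ n →
        c * ((n : ℝ) ^ d * oneArmProb d (criticalProbI d) n) ^ (t + 1) ≤
          ∫ ω, ((((box d n).filter fun z => ω ∈ (openConn (0 : Site d) z : Set (BondConfig (Site d)))).card : ℕ) : ℝ) ^ (t + 1) ∂ν ∧
        ∫ ω, ((((box d n).filter fun z => ω ∈ (openConn (0 : Site d) z : Set (BondConfig (Site d)))).card : ℕ) : ℝ) ^ (t + 1) ∂ν ≤
          C * ((n : ℝ) ^ d * oneArmProb d (criticalProbI d) n) ^ (t + 1) := by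
  obtain ⟨C₁, c₁, hC₁, hc₁, htail⟩ := iicMeasure_real_volume_le_le_rpow_Zd hd hs hsL hϰ hA2 hl hcU hCU hUAD
  obtain ⟨C₂, hC₂, hup⟩ := Rsw3.iicMeasure_integral_volume_pow_le hd hs hsL hϰ hA2 t
  -- `ε₀` with `C₁ ε₀^{c₁} ≤ 1/2`
  set ε₀ : ℝ := (1 / (2 * C₁)) ^ (1 / c₁) with hε₀
  have hε₀pos : 0 < ε₀ := by rw [hε₀]; positivity
  have hε₀tail : C₁ * ε₀ ^ c₁ ≤ 1 / 2 := by
    rw [hε₀, one_div c₁, Real.rpow_inv_rpow (by positivity) hc₁.ne']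
    rw [mul_one_div, div_le_iff₀ (by positivity)]
    linarith
  refine ⟨ε₀ ^ (t + 1) / 2, C₂, by positivity, hC₂, fun ν _ hν n hn => ⟨?_, hup ν hν n hn⟩⟩
  have h := htail ν hν n hn ε₀ hε₀pos
  exact integral_volume_pow_ge_of_lowerTail (criticalProbI d) hε₀pos (h.trans hε₀tail) (t + 1)

open Classical in
/-- **`ℤ³`: KESTEN'S THEOREM (8) IN ALL MOMENTS, TWO-SIDED, FROM `CU⁺_l` + X_B** (`p_c(ℤ³)`, `l ≥ 2`, `c_U > 0`; X_B = `CritAnnulusNonCrossing`,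
stmt-0846): (A2)□ at aspect `(l, l²)` is a consequence of `CU⁺_l` (gen 17 (11)) and X_B ⇒ UAD (gen 17 (10)), so for every `t` there are
`0 < c, C` with `c·(n³π_{p_c}(n))^{t+1} ≤ E_ν|C(0) ∩ Λ(n)|^{t+1} ≤ C·(n³π_{p_c}(n))^{t+1}` (`n ≥ 1`) for every IIC probability measure `ν`.
[cite: Kesten1986, Thm. (8)] [cite: BasuSapozhnikov2017ECP, Thm. 1.1] -/
theorem iicMeasure_integral_volume_pow_two_sided_Z3_of_robustCondAnnulusUniq_of_critAnnulusNonCrossing {l : ℕ} (hl : 2 ≤ l)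
    {cU : ℝ} (hcU : 0 < cU)
    (hCU : ∀ a : ℕ, 1 ≤ a → ∀ E : Set (BondConfig (Site 3)), IsUpperSet E → MeasurableSet E →
      cU * (bondPercolation (zdGraph 3) (criticalProbI 3)).real E ≤ (bondPercolation (zdGraph 3) (criticalProbI 3)).real (E ∩
        {ω : BondConfig (Site 3) | ∀ t ∈ innerBoundary (zdGraph 3) (box 3 a), ∀ s ∈ innerBoundary (zdGraph 3) (box 3 (l * a)),
          ∀ t' ∈ innerBoundary (zdGraph 3) (box 3 a), ∀ s' ∈ innerBoundary (zdGraph 3) (box 3 (l * a)),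
          ω ∈ openConnIn (↑((box 3 (l * a) \ box 3 a) ∪ innerBoundary (zdGraph 3) (box 3 a)) : Set (Site 3)) t s →
          ω ∈ openConnIn (↑((box 3 (l * a) \ box 3 a) ∪ innerBoundary (zdGraph 3) (box 3 a)) : Set (Site 3)) t' s' →
          ω ∈ openConnIn (↑((box 3 (l * a) \ box 3 a) ∪ innerBoundary (zdGraph 3) (box 3 a)) : Set (Site 3)) s s'}))
    (hXB : PercAnnulusCrossing.CritAnnulusNonCrossing) (t : ℕ) :
    ∃ c C : ℝ, 0 < c ∧ 0 < C ∧ ∀ (ν : Measure (BondConfig (Site 3))) [IsProbabilityMeasure ν],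
      (∀ (K : Finset (Sym2 (Site 3))) (E : Set (BondConfig (Site 3))), MeasurableSet E → DeterminedBy E ↑K →
        Tendsto (fun n : ℕ => (bondPercolation (zdGraph 3) (criticalProbI 3)).real (E ∩ siteToBoundary 3 n) /
          oneArmProb 3 (criticalProbI 3) n) atTop (𝓝 (ν.real E))) →
      ∀ n : ℕ, 1 ≤ n →
        c * ((n : ℝ) ^ 3 * oneArmProb 3 (criticalProbI 3) n) ^ (t + 1) ≤
          ∫ ω, ((((box 3 n).filter fun z => ω ∈ (openConn (0 : Site 3) z : Set (BondConfig (Site 3)))).card : ℕ) : ℝ) ^ (t + 1) ∂ν ∧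
        ∫ ω, ((((box 3 n).filter fun z => ω ∈ (openConn (0 : Site 3) z : Set (BondConfig (Site 3)))).card : ℕ) : ℝ) ^ (t + 1) ∂ν ≤
          C * ((n : ℝ) ^ 3 * oneArmProb 3 (criticalProbI 3) n) ^ (t + 1) := by
  have hA2 := setToSetQuasiMultAspectAt_of_robustCondAnnulusUniq (d := 3) (by norm_num) hl hcU.le hCU
  exact iicMeasure_integral_volume_pow_two_sided_of_robustCondAnnulusUniq (d := 3) (by norm_num) hl (by nlinarith) (by positivity)
    hA2 hl hcU hCU (uad_of_critAnnulusNonCrossing hXB) t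

end Summit.CriticalPhenomena.PercolationContinuityZ3.Theorems.Crossing

end
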